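import Literature.AlgebraicGeometry.Hironaka2017.S02Preliminaries.R001IdealExponents
import Literature.AlgebraicGeometry.Resolution.ColonIdealSheafFG
import Literature.AlgebraicGeometry.Resolution.StalkIdealLemmas
import HarnessLib

/-!
# [OURS · L1 W4.6, rungs (i)/(ii) — the dictionary, SCHEME HALF, brick 12] The stalk of the transform `E′ = (J′, b)` at a
# point with chart data: if `J_ξ = (f₀)` and `π^♯ f₀ = π^♯(cᵢ)^b · f′`, then `J′_{ξ′} = (f′)`

Cell res-hironaka (LADDER-RESOLUTION rung L, D-0089), slot W4.6, seat res-L1-s46-pv-2 (gen 2). Host: route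
`WildCones`, crux `ClassicalRegimes` (stmt-ResolutionOfSingularities-16884), `--supports … --as helper`.

HONEST FRAMING. Everything here is OURS: bookkeeping over the tree's controlled transform of an ideal sheaf under a
blowing up (`Resolution.controlledTransform`, `IsBlowup.stalkIdeal_controlledTransform` — BGMW §3.2 —,
`stalkIdeal_comap_eq_map_stalkMap`), applied to the typed carrier `IdealExponent.transform` of row 001
(`Literature.AlgebraicGeometry.Hironaka2017.S02Preliminaries`, Def. 2.1 p.5: a DEFINITION rendering the manuscript's
transform with the tree's controlled transform; used as a definition only). NOTHING here asserts any statement of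
H. Hironaka's manuscript [Hironaka2017]; no FACT-LIST premise. AI review is weaker than expert review.

## Statement (`stalkIdeal_transform_eq_span`)

For a blow-up `π : Z′ → Z` along `𝓘_D` (`IsBlowup π (vanishingIdeal D)`), a point `ξ′` with ring-level chart data at
`π ξ′` — generators `c` of `𝓘_{D, π ξ′}` with `π^♯(c_j) = π^♯(cᵢ) · e_j` and `π^♯(cᵢ)` a non-zero-divisor (bricks 6/10)
— and an ideal exponent `E = (J, b)` whose stalk at `π ξ′` is principal, `J_{π ξ′} = (f₀)`: if `π^♯ f₀ = π^♯(cᵢ)^b · f′`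
then the stalk of the transform `E′ = E.transform π D` at `ξ′` is `(f′)`. This identifies the `f′` of bricks 8/9
(`AtomGerm.exists_ringEquiv_transform_atom`, `transform_mem_pow_iff_multP`) with the typed transform, so that
`ξ′ ∈ Sing(E′)` (`b ≤ ord_{ξ′} J′`, row 001 `IdealExponent.sing`, tree `le_idealOrder_iff`) reads `f′ ∈ 𝔪_{ξ′}^b`
(`mem_sing_transform_iff`).

References: E. Bierstone, D. Grigoriev, P. Milman, J. Włodarczyk, *Effective Hironaka resolution …* (2011), §3.2 (controlled
transform); The Stacks Project, Tag 0804; H. Hironaka, ms. 2017, Def. 2.1 p.5 — ROLE only, under adjudication, not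
cited as fact. [BierstoneGrigorievMilmanWlodarczyk2011] [StacksProject] [folklore]
-/

noncomputable section

-- single-problem summit: the doubled namespace component `ResolutionOfSingularities` is forced
set_option linter.dupNamespace false

open CategoryTheory AlgebraicGeometry TopologicalSpace IsLocalRing

namespace Summit.ResolutionOfSingularities.ResolutionOfSingularities.Theorems

namespace CampaignW46.ChartPoint

open Literature.AlgebraicGeometry.Resolution
open Literature.AlgebraicGeometry.Hironaka2017.S02Preliminaries
open Scheme.IdealSheafData

universe u

/-- In a commutative ring, `((a·f) : (a)) = (f)` for a non-zero-divisor `a`. [folklore] -/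
theorem colon_span_singleton_mul_eq {A : Type*} [CommRing A] {a : A} (ha : a ∈ nonZeroDivisors A) (f : A) :
    (Ideal.span {a * f}).colon (Ideal.span {a} : Set A) = Ideal.span {f} := by
  ext x
  rw [Submodule.mem_colon_span_singleton, smul_eq_mul, Ideal.mem_span_singleton', Ideal.mem_span_singleton']
  constructor
  · rintro ⟨t, ht⟩
    refine ⟨t, ?_⟩
    have h1 : (t * f) * a = x * a := by rw [← ht]; ring
    exact (mul_cancel_right_mem_nonZeroDivisors ha).1 h1
  · rintro ⟨t, rfl⟩
    exact ⟨t, by ring⟩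

variable {Z Z' : Scheme.{u}} {π : Z' ⟶ Z} {D : Closeds Z}

/-- [OURS · L1 W4.6 — DICTIONARY, SCHEME HALF, brick 12; replaces the role of «the transform `E′ = (J′, b)`,
`J 𝒪_{Z′} = I(D)^b J′`» (H. Hironaka, ms. 2017, Def. 2.1 p.5 l.2–3) at a point with chart data; NOT a statement of
the manuscript] **The stalk of the transform is generated by the quotient `f′ = π^♯f₀ / π^♯(cᵢ)^b`.** [folklore] -/
theorem stalkIdeal_transform_eq_span (hπ : IsBlowup π (vanishingIdeal D)) (ξ' : Z') {σ : Type}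
    (c : σ → Z.presheaf.stalk (π ξ')) (hcJ : Ideal.span (Set.range c) = stalkIdeal (vanishingIdeal D) (π ξ'))
    (i : σ) (e : σ → Z'.presheaf.stalk ξ') (he : ∀ j, (π.stalkMap ξ').hom (c j) = (π.stalkMap ξ').hom (c i) * e j)
    (hnzd : (π.stalkMap ξ').hom (c i) ∈ nonZeroDivisors (Z'.presheaf.stalk ξ'))
    (E : IdealExponent Z) (f₀ : Z.presheaf.stalk (π ξ')) (hJ : stalkIdeal E.J (π ξ') = Ideal.span {f₀})
    (f' : Z'.presheaf.stalk ξ') (hf' : (π.stalkMap ξ').hom f₀ = (π.stalkMap ξ').hom (c i) ^ E.b * f') :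
    stalkIdeal (E.transform π D).J ξ' = Ideal.span {f'} := by
  set g := (π.stalkMap ξ').hom with hg
  -- the exceptional ideal at `ξ′` is `(g cᵢ)`
  have hexc : stalkIdeal ((vanishingIdeal D).comap π) ξ' = Ideal.span {g (c i)} := by
    rw [stalkIdeal_comap_eq_map_stalkMap, ← hcJ, Ideal.map_span, ← Set.range_comp]
    apply le_antisymm
    · rw [Ideal.span_le]
      rintro _ ⟨j, rfl⟩
      rw [SetLike.mem_coe, Function.comp_apply, ← hg, he j]
      exact Ideal.mul_mem_right _ _ (Ideal.subset_span rfl)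
    · rw [Ideal.span_singleton_le_iff_mem]
      exact Ideal.subset_span ⟨i, rfl⟩
  have hJ' : stalkIdeal (E.J.comap π) ξ' = Ideal.span {g (c i) ^ E.b * f'} := by
    rw [stalkIdeal_comap_eq_map_stalkMap, hJ, Ideal.map_span, Set.image_singleton, ← hg, hf']
  change stalkIdeal (controlledTransform π (vanishingIdeal D) E.J E.b) ξ' = _
  rw [hπ.stalkIdeal_controlledTransform, hJ', hexc, Ideal.span_singleton_pow]
  exact colon_span_singleton_mul_eq (pow_mem hnzd E.b) f'

/-- [OURS · L1 W4.6 — DICTIONARY for «`ξ′ ∈ Sing(E′)`»; NOT a statement of the manuscript] With the stalk of the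
transform generated by `f′`: `ξ′ ∈ Sing(E′)` (row 001 `IdealExponent.sing`: `b ≤ ord_{ξ′} J′`) iff `f′ ∈ 𝔪_{ξ′}^b`.
[folklore] -/
theorem mem_sing_transform_iff (E : IdealExponent Z) (ξ' : Z') (f' : Z'.presheaf.stalk ξ')
    (h : stalkIdeal (E.transform π D).J ξ' = Ideal.span {f'}) :
    ξ' ∈ (E.transform π D).sing ↔ f' ∈ maximalIdeal (Z'.presheaf.stalk ξ') ^ E.b := by
  change ((E.transform π D).b : ℕ∞) ≤ idealOrder (E.transform π D).J ξ' ↔ _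
  rw [le_idealOrder_iff, h, Ideal.span_singleton_le_iff_mem]
  rfl

end CampaignW46.ChartPoint

end Summit.ResolutionOfSingularities.ResolutionOfSingularities.Theorems

end
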